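import Summits.CriticalPhenomena.PercolationContinuityZ3.Theorems.Transplant.SkelNegBParamsRootArithY
import Summits.CriticalPhenomena.PercolationContinuityZ3.Theorems.Transplant.SkelNegBParamsRootArithA
import HarnessLib

/-!
# N1 params, chain of record `NegB`, part RootArithY-A — the (ζ′) twin of part RootArithY: THE INTEGER ARITHMETIC OF THE y′-RUN's FINE READINGS at a
# generic even lattice constant `A` with box multiplier `Q` (reading units `u = s₀`/`s₁`, `D = A²m`, targets `20r₁ ± (b0TA₁ − 1) = 800Qu ± (10Qu − 1)`,
# `±(b0TA₀ − 1) = ±(10Qu − 1)`, region targets `[−5r₁+1, 25r₁−1]` with `r₁ = 40Qu`, `N + 1 ≤ 1000Q`, floors `2000Q(RA′+2) ≤ n_L`, `22000Q(RA′+2) ≤ ℓ_L`);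
# the window lemmas `mul_window/levels_window/levels_abs` of part RootArithY are `A`-free and reused.
* **`levelH_windowA`**, **`transY_lastA`**, **`alongY_posA`**, **`alongY_negA`**, **`regionY_alongA`**.  (stmt-g16 2026-08-22; NEG-SCOPE §B.19 (ζ′).)
builds on p205010 (kernel theorem, internal audit signed; external expert review pending) — nothing in this file uses p205010; NOTHING is claimed about
the node `SamePDropOfSkeletonNeg₁` (OPEN).  Pure arithmetic; no definitions.
Lane `prim-bschramm-*`, seat `prim-bschramm-stmt` (gen 16); helper file (`--supports stmt-CriticalPhenomena-4575 --as helper`); ledger HOME/prim-bschramm-stmt/NEG-PARAMS.md.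
[cite: KozmaNitzan2024, §4 p. 28 ((32) at the root), Lemma 11 (p. 22)] [cite: MartineauTassion2017, §3.2, §4.3 Lemma 4.2]
-/

namespace Summit.CriticalPhenomena.PercolationContinuityZ3.Theorems.Transplant

namespace PlanarSkeletonNeg

namespace NegB

namespace RootArithA

open RootArith (floor_sandwich mul_window levels_window levels_abs)

/-- **The level reading** `H(X) := (A·u·(A·X))/(A²m) = ⌊uX/m⌋` of a term within `r` of `σ'·K·m`: `σ'uK − cu ≤ H ≤ σ'uK + cu − 1` once `r + 1 ≤ c·m`. [folklore] -/
theorem levelH_windowA {A u m X K r c σ' : ℤ} (hA : 0 < A) (hu : 1 ≤ u) (hm : 0 < m) (hX : |X - σ' * (K * m)| ≤ r) (hr : r + 1 ≤ c * m) :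
    σ' * u * K - c * u ≤ (A * u * (A * X)) / (A ^ 2 * m) ∧ (A * u * (A * X)) / (A ^ 2 * m) ≤ σ' * u * K + c * u - 1 := by
  obtain ⟨t1, t2⟩ := trans_boundsA (u := u) (m := m) (Y := X) hA hm
  set H := (A * u * (A * X)) / (A ^ 2 * m)
  obtain ⟨x1, x2⟩ := abs_le.1 hX
  have hu0 : 0 ≤ u := by linarith
  have y1 := mul_le_mul_of_nonneg_left x1 hu0
  have y2 := mul_le_mul_of_nonneg_left x2 hu0
  have hr' := mul_le_mul_of_nonneg_left hr hu0
  constructor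
  · by_contra hcn; push Not at hcn
    have h1 : m * H ≤ m * (σ' * u * K - c * u - 1) := mul_le_mul_of_nonneg_left (by linarith) hm.le
    nlinarith
  · by_contra hcn; push Not at hcn
    have h1 : m * (σ' * u * K + c * u) ≤ m * H := mul_le_mul_of_nonneg_left (by linarith) hm.le
    nlinarith

/-- **y′-RUN, LAST CORE, ACROSS (fine axis 0), either sign `σ'`** ((ζ′) twin of `RootArith.transY_last`): the fine abscissa of the last core of the
y′-run lies in `±(10Qu − 1)` (`u = s₀ ≥ 17`). Data as in the twin (transverse window, levels, `nΛ = nΛx + 4σu·n·m + σ'·v·m + v·ρ`, `4|Λx| ≤ 7m`).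
[cite: KozmaNitzan2024, §4 Lemma 11 (p. 22)] -/
theorem transY_lastA {A Q u m n U v ℓ RA N Λ Λx ρ σ' σu aL aH bL bH rβ : ℤ} (hA : 2 ≤ A) (hAe : 2 ∣ A) (hQ : 1 ≤ Q) (hu : 17 ≤ u) (hn : 1 ≤ n)
    (hm : n * (ℓ - 1) < m) (hU : n ≤ U) (hU' : U ≤ 11 * n) (hv : |v| ≤ n) (hRA : 0 ≤ RA) (hRAn : 2000 * Q * (RA + 2) ≤ n) (hRAℓ : 22000 * Q * (RA + 2) ≤ ℓ)
    (hN : 0 ≤ N) (hN' : N + 1 ≤ 1000 * Q) (hσ : σ' = 1 ∨ σ' = -1) (hσu : σu = 1 ∨ σu = -1)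
    (haL : (N + 1) * v - v - (n + (N + 1) * RA) ≤ aL) (haLH : aL ≤ aH) (haH : aH ≤ (N + 1) * v - v + (n + (N + 1) * RA))
    (hbL : (N + 1) * m - rβ ≤ U * bL - U) (hbLH : bL ≤ bH) (hbH : U * bH + U - 1 ≤ (N + 1) * m + rβ) (hrβ : 0 ≤ rβ) (hrβ' : rβ ≤ 2 * m + 3 * n)
    (hΛ : n * Λ = n * Λx + 4 * σu * n * m + σ' * v * m + v * ρ) (hρ : 0 ≤ ρ) (hρ' : ρ < n) (hΛx : 4 * |Λx| ≤ 7 * m) :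
    -(10 * Q * u - 1) ≤ (A * u * (A * Λ) + A ^ 2 * m / 2) / (A ^ 2 * m) +
        (A * u * (A * (m * (min (σ' * aL) (σ' * aH)) -
          max (v * (U * (min (σ' * bL) (σ' * bH) - 1))) (v * (U * (max (σ' * bL) (σ' * bH)) + U - 1))) / n)) / (A ^ 2 * m) ∧
      (A * u * (A * Λ) + A ^ 2 * m / 2) / (A ^ 2 * m) +
        (A * u * (A * (m * (max (σ' * aL) (σ' * aH)) -
          min (v * (U * (min (σ' * bL) (σ' * bH) - 1))) (v * (U * (max (σ' * bL) (σ' * bH)) + U - 1))) / n)) / (A ^ 2 * m) + 1 ≤ 10 * Q * u - 1 := by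
  have hn0 : 0 < n := by linarith
  have hA0 : 0 < A := by linarith
  have hQRA : 0 ≤ Q * RA := mul_nonneg (by linarith) hRA
  have hℓ1 : 44000 ≤ ℓ := by linarith
  have hm0 : 0 < m := by
    have := mul_le_mul_of_nonneg_left (show (0:ℤ) ≤ ℓ - 1 by linarith) hn0.le
    linarith
  have hu0 : 0 ≤ u := by linarith
  have hU0 : 0 ≤ U := by linarith
  have hNR : 0 ≤ (N + 1) * RA := mul_nonneg (by linarith) hRA
  have hNR' : (N + 1) * RA ≤ 1000 * Q * RA := mul_le_mul_of_nonneg_right hN' hRA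
  -- the transverse and level windows in `σ'`-orientation
  set ca := σ' * ((N + 1) * v - v) with hca
  set ra := n + (N + 1) * RA with hra
  have hamin : ca - ra ≤ min (σ' * aL) (σ' * aH) ∧ max (σ' * aL) (σ' * aH) ≤ ca + ra := by
    rcases hσ with rfl | rfl
    · simp only [one_mul] at hca ⊢; rw [min_eq_left haLH, max_eq_right haLH, hca]; constructor <;> linarith
    · simp only [neg_mul, one_mul] at hca ⊢
      rw [min_eq_right (by linarith : -aH ≤ -aL), max_eq_left (by linarith : -aH ≤ -aL), hca]; constructor <;> linarith
  set cβ := σ' * ((N + 1) * m) with hcβ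
  have hUb : U * bL ≤ U * bH := mul_le_mul_of_nonneg_left hbLH hU0
  have hlev : |U * (min (σ' * bL) (σ' * bH)) - U - cβ| ≤ rβ + U ∧ |U * (max (σ' * bL) (σ' * bH)) + U - 1 - cβ| ≤ rβ + U := by
    rcases hσ with rfl | rfl
    · simp only [one_mul] at hcβ ⊢; rw [min_eq_left hbLH, max_eq_right hbLH, hcβ]
      constructor <;> (rw [abs_le]; constructor <;> linarith)
    · simp only [neg_mul, one_mul] at hcβ ⊢
      rw [min_eq_right (by linarith : -bH ≤ -bL), max_eq_left (by linarith : -bH ≤ -bL), hcβ]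
      have e1 : U * -bH = -(U * bH) := by ring
      have e2 : U * -bL = -(U * bL) := by ring
      rw [e1, e2]
      constructor <;> (rw [abs_le]; constructor <;> linarith)
  obtain ⟨hBmax, hBmin⟩ := levels_window (v := v) hlev.1 hlev.2
  set Bmax := max (v * (U * (min (σ' * bL) (σ' * bH) - 1))) (v * (U * (max (σ' * bL) (σ' * bH)) + U - 1))
  set Bmin := min (v * (U * (min (σ' * bL) (σ' * bH) - 1))) (v * (U * (max (σ' * bL) (σ' * bH)) + U - 1))
  set amin := min (σ' * aL) (σ' * aH)
  set amax := max (σ' * aL) (σ' * aH)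
  have hElo : m * amin - Bmax ≥ -(σ' * (m * v)) - m * ra - |v| * (rβ + U) := by
    have h1 := mul_le_mul_of_nonneg_left hamin.1 hm0.le
    have e : m * (ca - ra) - (v * cβ + |v| * (rβ + U)) = -(σ' * (m * v)) - m * ra - |v| * (rβ + U) := by rw [hca, hcβ]; ring
    linarith
  have hEhi : m * amax - Bmin ≤ -(σ' * (m * v)) + m * ra + |v| * (rβ + U) := by
    have h1 := mul_le_mul_of_nonneg_left hamin.2 hm0.le
    have e : m * (ca + ra) - (v * cβ - |v| * (rβ + U)) = -(σ' * (m * v)) + m * ra + |v| * (rβ + U) := by rw [hca, hcβ]; ring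
    linarith
  -- sizes
  have hra' : 2 * ra ≤ 3 * n := by rw [hra]; linarith
  have hvr : |v| * (rβ + U) ≤ n * (2 * m + 14 * n) := mul_le_mul hv (by linarith) (by linarith) hn0.le
  have hm4 : 40000 * n ≤ m := by
    have := mul_le_mul_of_nonneg_left (show (43999:ℤ) ≤ ℓ - 1 by linarith) hn0.le
    linarith
  -- the origin's fine abscissa
  obtain ⟨f1, f2⟩ := coarse_boundsA (u := u) (Λ := Λ) hA0 hAe hm0
  set F := (A * u * (A * Λ) + A ^ 2 * m / 2) / (A ^ 2 * m)
  obtain ⟨hΛx1, hΛx2⟩ := abs_le.1 (show |Λx| ≤ 2 * m by linarith [abs_nonneg Λx])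
  have hΛx4 := abs_le.1 (show |4 * Λx| ≤ 7 * m by rw [abs_mul]; simpa using hΛx)
  have hvρ : |v * ρ| ≤ n * n := by rw [abs_mul, abs_of_nonneg hρ]; exact mul_le_mul hv hρ'.le hρ hn0.le
  obtain ⟨hvρ1, hvρ2⟩ := abs_le.1 hvρ
  have hσ'v : |σ' * (m * v)| ≤ m * n := by
    have : |σ'| = 1 := by rcases hσ with h | h <;> simp [h]
    rw [abs_mul, this, one_mul, abs_mul, abs_of_pos hm0]; exact mul_le_mul_of_nonneg_left hv hm0.le
  have hF1 : n * (2 * m * F) ≤ n * (2 * u * Λ + m) := mul_le_mul_of_nonneg_left f1 hn0.le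
  have hF2 : n * (2 * u * Λ + m) < n * (2 * m * F + 2 * m) := mul_lt_mul_of_pos_left f2 hn0
  have euΛ : u * (n * Λ) = u * (n * Λx) + 4 * u * σu * (n * m) + u * σ' * (v * m) + u * (v * ρ) := by rw [hΛ]; ring
  have hσu8 : u * σu * (n * m) ≥ -(u * (n * m)) ∧ u * σu * (n * m) ≤ u * (n * m) := by
    have hX : 0 ≤ u * (n * m) := by positivity
    have e : u * σu * (n * m) = σu * (u * (n * m)) := by ring
    rw [e]; rcases hσu with h | h <;> rw [h] <;> constructor <;> linarith
  have t1 := mul_le_mul_of_nonneg_left hΛx4.1 (mul_nonneg hu0 hn0.le)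
  have t1' := mul_le_mul_of_nonneg_left hΛx4.2 (mul_nonneg hu0 hn0.le)
  have t2 := mul_le_mul_of_nonneg_left hra' (mul_nonneg hu0 hm0.le)
  have t3 := mul_le_mul_of_nonneg_left hvr hu0
  have t4 := mul_le_mul_of_nonneg_left hvρ1 hu0
  have t4' := mul_le_mul_of_nonneg_left hvρ2 hu0
  have t5 := mul_le_mul_of_nonneg_left hm4 (mul_nonneg hu0 hn0.le)
  have t11 := mul_le_mul_of_nonneg_left hn (mul_nonneg hu0 hn0.le)
  have t6 : 0 ≤ u * (n * m) := by positivity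
  have t7 : 17 * (n * m) ≤ u * (n * m) := mul_le_mul_of_nonneg_right hu (by positivity)
  have hQP : u * (n * m) ≤ Q * (u * (n * m)) := le_mul_of_one_le_left t6 hQ
  have hmn0 : 0 < m * n := mul_pos hm0 hn0
  constructor
  · obtain ⟨-, g2⟩ := incr_boundsA (A := A) (u := u) (m := m) (n := n) (X := m * amin - Bmax) (by linarith) hu0 hm0 hn0
    set G := A * u * (A * (m * amin - Bmax) / n) / (A ^ 2 * m)
    have k0 := mul_le_mul_of_nonneg_left hElo hu0
    have k1 : m * n * G ≥ u * (-(σ' * (m * v)) - m * ra - |v| * (rβ + U)) - u * n - m * n := by linarith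
    have key : 2 * m * n * (F + G + 10 * Q * u - 1) > 0 := by
      have e : 2 * m * n * (F + G + 10 * Q * u - 1) = n * (2 * m * F) + 2 * (m * n * G) + 20 * (Q * (u * (n * m))) - 2 * (m * n) := by ring
      rw [e]
      have eΛ : n * (2 * u * Λ + m) = 2 * (u * (n * Λ)) + n * m := by ring
      rw [eΛ] at hF2
      have hF2' : n * (2 * m * F) > 2 * (u * (n * Λ)) + n * m - 2 * (m * n) := by
        have : n * (2 * m * F + 2 * m) = n * (2 * m * F) + 2 * (m * n) := by ring
        rw [this] at hF2; linarith
      rw [euΛ] at hF2'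
      linarith [hσu8.1, t1, t2, t3, t4, t5, t6, t7, t11, k1, hF2', hQP]
    have hmn : (0 : ℤ) < 2 * m * n := by positivity
    have hX : 0 < F + G + 10 * Q * u - 1 := by
      by_contra hc; push Not at hc
      have := mul_nonpos_of_nonneg_of_nonpos hmn.le hc
      linarith
    linarith
  · obtain ⟨g1, -⟩ := incr_boundsA (A := A) (u := u) (m := m) (n := n) (X := m * amax - Bmin) (by linarith) hu0 hm0 hn0
    set G := A * u * (A * (m * amax - Bmin) / n) / (A ^ 2 * m)
    have k1 : m * n * G ≤ u * (-(σ' * (m * v)) + m * ra + |v| * (rβ + U)) := by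
      have := mul_le_mul_of_nonneg_left hEhi hu0; linarith
    have key : 2 * m * n * (F + G + 2 - 10 * Q * u) < 0 := by
      have e : 2 * m * n * (F + G + 2 - 10 * Q * u) = n * (2 * m * F) + 2 * (m * n * G) + 4 * (m * n) - 20 * (Q * (u * (n * m))) := by ring
      rw [e]
      have eΛ : n * (2 * u * Λ + m) = 2 * (u * (n * Λ)) + n * m := by ring
      rw [eΛ, euΛ] at hF1
      linarith [hσu8.2, t1', t2, t3, t4', t5, t6, t7, k1, hF1, hQP]
    have hmn : (0 : ℤ) < 2 * m * n := by positivity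
    have hX : F + G + 2 - 10 * Q * u < 0 := by
      by_contra hc; push Not at hc
      have := mul_nonneg hmn.le hc
      linarith
    linarith

/-- **y′-RUN, LAST CORE, ALONG (fine axis 1), `σ' = 1`** ((ζ′) twin of `RootArith.alongY_pos`): `800Qu − 10Qu + 1 ≤ LLO₁`, `LHI₁ + 1 ≤ 800Qu + 10Qu − 1`
(`u = s₁`; centring `|F₁ + u(N+1) − 800Qu| ≤ u`). [cite: KozmaNitzan2024, §4 Lemma 11 (p. 22)] -/
theorem alongY_posA {A Q u m n U ℓ N Λ σ' bL bH rβ : ℤ} (hA : 0 < A) (hQ : 1 ≤ Q) (hu : 1 ≤ u) (hn : 1 ≤ n) (hm : n * (ℓ - 1) < m) (hU : n ≤ U)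
    (hU' : U ≤ 11 * n) (hRAℓ : 44000 ≤ ℓ) (hσ : σ' = 1) (hbL : (N + 1) * m - rβ ≤ U * bL - U) (hbLH : bL ≤ bH) (hbH : U * bH + U - 1 ≤ (N + 1) * m + rβ)
    (hrβ' : rβ ≤ 2 * m + 3 * n) (hcen : |(A * u * (A * Λ) + A ^ 2 * m / 2) / (A ^ 2 * m) + u * (N + 1) - 800 * Q * u| ≤ u) :
    800 * Q * u - 10 * Q * u + 1 ≤ (A * u * (A * Λ) + A ^ 2 * m / 2) / (A ^ 2 * m) + (A * u * (A * (U * (min (σ' * bL) (σ' * bH) - 1)))) / (A ^ 2 * m) ∧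
      (A * u * (A * Λ) + A ^ 2 * m / 2) / (A ^ 2 * m) + (A * u * (A * (U * (max (σ' * bL) (σ' * bH)) + U - 1))) / (A ^ 2 * m) + 1 ≤
        800 * Q * u + 10 * Q * u - 1 := by
  have hn0 : 0 < n := by linarith
  have hm0 : 0 < m := by have := mul_le_mul_of_nonneg_left (show (0:ℤ) ≤ ℓ - 1 by linarith) hn0.le; linarith
  have hm4 : 40000 * n ≤ m := by have := mul_le_mul_of_nonneg_left (show (43999:ℤ) ≤ ℓ - 1 by linarith) hn0.le; linarith
  have hQu : u ≤ Q * u := le_mul_of_one_le_left (by linarith) hQ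
  obtain ⟨l1, l2⟩ := levels_abs (K := N + 1) (by linarith) (Or.inl hσ) hbL hbLH hbH
  subst hσ
  have e1 : U * (min (1 * bL) (1 * bH) - 1) = U * (min (1 * bL) (1 * bH)) - U := by ring
  rw [e1]
  obtain ⟨a1, -⟩ := levelH_windowA (c := 3) (σ' := 1) hA hu hm0 l1 (by linarith)
  obtain ⟨-, b2⟩ := levelH_windowA (c := 3) (σ' := 1) hA hu hm0 l2 (by linarith)
  have hc := abs_le.1 hcen
  constructor <;> linarith

/-- **y′-RUN, LAST CORE, ALONG, `σ' = −1`** ((ζ′) twin of `RootArith.alongY_neg`): `800Qu − 10Qu + 1 ≤ −LHI₁ − 1`, `−LLO₁ ≤ 800Qu + 10Qu − 1`.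
[cite: KozmaNitzan2024, §4 Lemma 11 (p. 22)] -/
theorem alongY_negA {A Q u m n U ℓ N Λ σ' bL bH rβ : ℤ} (hA : 0 < A) (hQ : 1 ≤ Q) (hu : 1 ≤ u) (hn : 1 ≤ n) (hm : n * (ℓ - 1) < m) (hU : n ≤ U)
    (hU' : U ≤ 11 * n) (hRAℓ : 44000 ≤ ℓ) (hσ : σ' = -1) (hbL : (N + 1) * m - rβ ≤ U * bL - U) (hbLH : bL ≤ bH) (hbH : U * bH + U - 1 ≤ (N + 1) * m + rβ)
    (hrβ' : rβ ≤ 2 * m + 3 * n) (hcen : |(A * u * (A * Λ) + A ^ 2 * m / 2) / (A ^ 2 * m) - u * (N + 1) + 800 * Q * u| ≤ u) :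
    800 * Q * u - 10 * Q * u + 1 ≤ -((A * u * (A * Λ) + A ^ 2 * m / 2) / (A ^ 2 * m) + (A * u * (A * (U * (max (σ' * bL) (σ' * bH)) + U - 1))) / (A ^ 2 * m) + 1) ∧
      -((A * u * (A * Λ) + A ^ 2 * m / 2) / (A ^ 2 * m) + (A * u * (A * (U * (min (σ' * bL) (σ' * bH) - 1)))) / (A ^ 2 * m)) ≤ 800 * Q * u + 10 * Q * u - 1 := by
  have hn0 : 0 < n := by linarith
  have hm0 : 0 < m := by have := mul_le_mul_of_nonneg_left (show (0:ℤ) ≤ ℓ - 1 by linarith) hn0.le; linarith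
  have hm4 : 40000 * n ≤ m := by have := mul_le_mul_of_nonneg_left (show (43999:ℤ) ≤ ℓ - 1 by linarith) hn0.le; linarith
  have hQu : u ≤ Q * u := le_mul_of_one_le_left (by linarith) hQ
  obtain ⟨l1, l2⟩ := levels_abs (K := N + 1) (by linarith) (Or.inr hσ) hbL hbLH hbH
  subst hσ
  have e1 : U * (min (-1 * bL) (-1 * bH) - 1) = U * (min (-1 * bL) (-1 * bH)) - U := by ring
  rw [e1]
  obtain ⟨-, a2⟩ := levelH_windowA (c := 3) (σ' := -1) hA hu hm0 l2 (by linarith)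
  obtain ⟨b1, -⟩ := levelH_windowA (c := 3) (σ' := -1) hA hu hm0 l1 (by linarith)
  have hc := abs_le.1 hcen
  constructor <;> linarith

/-- **y′-RUN, REGION `k`, ALONG, `σ' = ±1`** ((ζ′) twin of `RootArith.regionY_along`): the level reading of region `k` (`0 ≤ k ≤ N`, terms within
`r ≤ 7m − 1` of `σ'km`) lies in `[−5r₁+1, 25r₁−1]` (`r₁ = 40Qu`), via the centring `|F₁ + σ'u(N+1) − σ'·800Qu| ≤ u` and `|Λ₁| ≤ 3m`.
[cite: KozmaNitzan2024, §4 p. 28] -/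
theorem regionY_alongA {A Q u m n ℓ N k Λ σ' X1 X2 r : ℤ} (hA : 0 < A) (hAe : 2 ∣ A) (hQ : 1 ≤ Q) (hu : 1 ≤ u) (hn : 1 ≤ n) (hm : n * (ℓ - 1) < m)
    (hRAℓ : 44000 ≤ ℓ) (hσ : σ' = 1 ∨ σ' = -1) (hk : 0 ≤ k) (hkN : k ≤ N) (hX1 : |X1 - σ' * (k * m)| ≤ r) (hX2 : |X2 - σ' * (k * m)| ≤ r)
    (hr : r + 1 ≤ 7 * m) (hΛ : |Λ| ≤ 3 * m)
    (hcen : |(A * u * (A * Λ) + A ^ 2 * m / 2) / (A ^ 2 * m) + σ' * u * (N + 1) - σ' * (800 * Q) * u| ≤ u) :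
    (σ' = 1 → -(5 * (40 * Q * u)) + 1 ≤ (A * u * (A * Λ) + A ^ 2 * m / 2) / (A ^ 2 * m) + (A * u * (A * X1)) / (A ^ 2 * m) ∧
        (A * u * (A * Λ) + A ^ 2 * m / 2) / (A ^ 2 * m) + (A * u * (A * X2)) / (A ^ 2 * m) + 1 ≤ 25 * (40 * Q * u) - 1) ∧
      (σ' = -1 → -(5 * (40 * Q * u)) + 1 ≤ -((A * u * (A * Λ) + A ^ 2 * m / 2) / (A ^ 2 * m) + (A * u * (A * X2)) / (A ^ 2 * m) + 1) ∧
        -((A * u * (A * Λ) + A ^ 2 * m / 2) / (A ^ 2 * m) + (A * u * (A * X1)) / (A ^ 2 * m)) ≤ 25 * (40 * Q * u) - 1) := by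
  have hn0 : 0 < n := by linarith
  have hm0 : 0 < m := by have := mul_le_mul_of_nonneg_left (show (0:ℤ) ≤ ℓ - 1 by linarith) hn0.le; linarith
  have hu0 : 0 ≤ u := by linarith
  have hQu : u ≤ Q * u := le_mul_of_one_le_left hu0 hQ
  obtain ⟨f1, f2⟩ := coarse_boundsA (u := u) (Λ := Λ) hA hAe hm0
  set F := (A * u * (A * Λ) + A ^ 2 * m / 2) / (A ^ 2 * m)
  obtain ⟨hΛ1, hΛ2⟩ := abs_le.1 hΛ
  have huΛlo : u * (-(3 * m)) ≤ u * Λ := mul_le_mul_of_nonneg_left hΛ1 hu0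
  have huΛhi : u * Λ ≤ u * (3 * m) := mul_le_mul_of_nonneg_left hΛ2 hu0
  have hFlo : -3 * u ≤ F := by
    by_contra hc; push Not at hc
    have h1 : 2 * m * F ≤ 2 * m * (-3 * u - 1) := mul_le_mul_of_nonneg_left (by linarith) (by linarith)
    linarith
  have hFhi : F ≤ 3 * u := by
    by_contra hc; push Not at hc
    have h1 : 2 * m * (3 * u + 1) ≤ 2 * m * F := mul_le_mul_of_nonneg_left (by linarith) (by linarith)
    linarith
  obtain ⟨a1, a2⟩ := levelH_windowA (c := 7) hA hu hm0 hX1 hr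
  obtain ⟨b1, b2⟩ := levelH_windowA (c := 7) hA hu hm0 hX2 hr
  have hc := abs_le.1 hcen
  have hukN : u * k ≤ u * N := mul_le_mul_of_nonneg_left hkN hu0
  have huk0 : 0 ≤ u * k := mul_nonneg hu0 hk
  constructor
  · intro h1; subst h1; simp only [one_mul] at a1 a2 b1 b2 hc; constructor <;> linarith
  · intro h1; subst h1; simp only [neg_mul, one_mul] at a1 a2 b1 b2 hc; constructor <;> linarith

end RootArithA

end NegB

end PlanarSkeletonNeg

end Summit.CriticalPhenomena.PercolationContinuityZ3.Theorems.Transplant
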